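import Summits.BirchSwinnertonDyer.BirchSwinnertonDyer.Theorems.GenusKolyvaginAtTwoGenusPrimitiveSupplyAtTwoArchimedeanDescentSign
import Summits.BirchSwinnertonDyer.Rank1Residual.F1Sign2.EggLemmaAtTwoProofs
import Summits.BirchSwinnertonDyer.Rank1Residual.X11b.KummerLocalIndex
import Literature.NumberTheory.EllipticCurves.Rank1Residual.Typed.X5DescentSelmer
import Literature.NumberTheory.EllipticCurves.SelmerGroupCardinality
import Mathlib.Algebra.Algebra.Hom.Rat
import HarnessLib

/-!
# Route `GenusKolyvaginAtTwo`, crux #2 `GenusPrimitiveSupplyAtTwo` (stmt-BirchSwinnertonDyer-22136):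
# the REAL EGG — `2E(ℝ)` misses the egg, points off the egg halve over `ℝ` — and the dictionary
# «`E(ℚ)` meets the egg ⟺ some class of `Sel₂(W)` is non-trivial at `∞`»

Width seat `bsd-line-gk2-p5` g10 (cell `bsd-f1-sign2`, SUPPLY lineage), file 30 of the series (sequel of
`…ArchimedeanDescentSign.lean` p640269). THEOREMS ONLY (no definition, no named fact, no `sorry`, no local instance); helper
`--supports stmt-BirchSwinnertonDyer-22136`; no item is closed; BSD is not proved by any of this.

WHAT. The level law of file 27 (§67–§68: for a descent-admissible `d`, `2·#Sel₂(W^{(d)}) = #Sel₂(W)` iff SOME class of `Sel₂(W)`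
is non-trivial at the real place, `#Sel₂(W^{(d)}) = 2·#Sel₂(W)` iff `Sel₂(W)` is STRICT at `∞`) left the cell's T-C
`F1Sign2.EggTwistLawAtTwo` (rank one, `Ш[2] = 0`, `Δ > 0`, `E(ℚ)[2] = 0`: the egg decides every admissible twist) one dictionary
entry away: «`E(ℚ)` meets the egg ⟺ some Selmer class is non-trivial at `∞`». This file proves the dictionary; the sequel
(`…ArchimedeanEggTwistLaw.lean`) concludes T-C.

* §73 THE REAL EGG (local; any model `W/ℚ`): `root_le_of_mul_psiTwo_eq_real` (root domination over `ℝ`);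
  `not_onEgg_of_add_self_eq_real` / `not_onEgg_of_add_self_eq_baseChange` — **`2E(K)` misses the egg for every `ℚ`-field
  `K → ℝ`** (duplication formula `X(2R)·ψ₂(u) = u⁴ − b₄u² − 2b₆u − b₈` and the square identity of `F1Sign2.EggDoubling`, over
  `ℝ`); `exists_splitTwoTorsion_baseChange_real_of_Δ_pos`; `exists_add_self_eq_real_of_not_onEgg` /
  `exists_add_self_eq_baseChange_of_not_onEgg` — **for `Δ > 0` a rational point OFF the egg with `ψ₂(x) ≠ 0` is `2`-divisible in
  `E(K)` for every `ℚ`-field `K ≃+* ℝ`** (real `2`-descent: the three `x − e_i > 0` are squares, tree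
  `Affine.Point.exists_add_self_of_twoDescentComponent_eq_one`).
* §74 THE DICTIONARY (global): `localization_kummerMapTorsion_eq_localKummerMap` / `…_eq_zero_iff` (any number field, any place:
  `loc_v κ_n(P) = κ_{n,v}(P_v)`, `= 0 ⟺ P_v ∈ nE(K_v)`; tree X11b `res_kummerMapTorsion_eq_localKummerMap`, `ker_localKummerMap`);
  **`exists_mem_selmerGroup_localization_inl_ne_zero_of_meetsEgg`** — `MeetsEgg W ⟹` the Kummer class of the egg point is a class
  of `Sel₂(W)` non-trivial at `∞` (ANY elliptic `W/ℚ`); **`forall_mem_selmerGroup_localization_inl_eq_zero_of_not_meetsEgg`** —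
  `¬ MeetsEgg W ⟹ Sel₂(W)` strict at `∞`, under `Δ > 0`, `E(ℚ)[2] = 0`, `Ш(W)[2] = 0` (every Selmer class is then `κ(P)`, exactness
  `mem_range_kummerMapTorsion_of_torsionH1ToH1_eq_zero`, and `P` off the egg halves over `ℚ_∞`);
  `meetsEgg_iff_exists_localization_inl_ne_zero`; `selmerTwoCard_eq_two_of_rank_one` — `#Sel₂(W) = 2` for rank one,
  `E(ℚ)[2] = 0`, `Ш[2] = 0` (descent count `card_selmerGroup_eq_pow_rank_mul`).

References: [Kramer1981] §2 Prop. 6 (`E(ℝ)/2E(ℝ)`, p. 127); [SilvermanAEC2009] III.2.3 (d), VIII.§2, X.1.4, X.4.2 (a); [Knapp1993]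
Thm. 4.2; [BrumerKramer1977] Prop. 3.7.
-/

set_option linter.dupNamespace false -- tree convention: `Summit.BirchSwinnertonDyer.BirchSwinnertonDyer.Theorems` (summit = sub-problem)
set_option autoImplicit false

noncomputable section

open scoped Classical ContRepresentation ComplexConjugate

namespace Summit.BirchSwinnertonDyer.BirchSwinnertonDyer.Theorems.GenusKolyArch

open WeierstrassCurve Field NumberField IsDedekindDomain Function
open Literature.NumberTheory.EllipticCurves Literature.NumberTheory.GaloisRepresentations
open Literature.NumberTheory.GaloisCohomology
open Summit.BirchSwinnertonDyer.Rank1Residual.F1Sign2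
open Summit.BirchSwinnertonDyer.Rank1Residual.F1Sign2.EggDoubling
  (psiTwo dupNum sub_negY_sq_eq_psiTwo addX_self_mul_psiTwo four_mul_dupNum_sub_root_mul_psiTwo psiTwo_map psiTwo_ne_zero
    eq_zero_of_two_smul_eq_zero)

universe u

/-! ## §73 The real egg: `2E(ℝ)` misses the egg; off the egg, points halve over `ℝ` (`Δ > 0`) -/

section RealEgg

variable (W : WeierstrassCurve ℚ)

/-- The `2`-division cubic of `W/ℝ` at a real argument is the real cubic of `F1Sign2.OnEgg`. [folklore] -/
theorem psiTwo_baseChange_real (e : ℝ) :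
    psiTwo (W.baseChange ℝ) e = 4 * e ^ 3 + (W.b₂ : ℝ) * e ^ 2 + 2 * (W.b₄ : ℝ) * e + (W.b₆ : ℝ) := by
  have h₂ : (W.baseChange ℝ).b₂ = algebraMap ℚ ℝ W.b₂ := W.map_b₂ _
  have h₄ : (W.baseChange ℝ).b₄ = algebraMap ℚ ℝ W.b₄ := W.map_b₄ _
  have h₆ : (W.baseChange ℝ).b₆ = algebraMap ℚ ℝ W.b₆ := W.map_b₆ _
  rw [psiTwo, h₂, h₄, h₆, eq_ratCast, eq_ratCast, eq_ratCast]

/-- `ψ₂ = 4 ∏ (X − e_i)` when the `2`-torsion is split. [cite: SilvermanAEC2009, Prop. X.1.4] -/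
theorem psiTwo_eq_of_splitTwoTorsion {F : Type*} [Field F] {V : WeierstrassCurve F} {e₁ e₂ e₃ : F}
    (h : V.toAffine.SplitTwoTorsion e₁ e₂ e₃) (X : F) :
    psiTwo V X = 4 * ((X - e₁) * (X - e₂) * (X - e₃)) := by
  have hb₂ : V.b₂ = -4 * (e₁ + e₂ + e₃) := h.b₂_eq
  have hb₄ : V.b₄ = 2 * (e₁ * e₂ + e₁ * e₃ + e₂ * e₃) := h.b₄_eq
  have hb₆ : V.b₆ = -4 * (e₁ * e₂ * e₃) := h.b₆_eq
  rw [psiTwo, hb₂, hb₄, hb₆]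
  ring

/-- **Root domination over `ℝ`.** For a real point `(u, v)` with `v ≠ −v − a₁u − a₃` on `V/ℝ` and any real `X` with
`X · ψ₂(u) = u⁴ − b₄u² − 2b₆u − b₈` (e.g. `X = x(2(u,v))`), every real root `e` of `ψ₂` satisfies `e ≤ X`:
`ψ₂(u) = (2v + a₁u + a₃)² > 0` and `4(X − e)ψ₂(u) = 4(dupNum(u) − e ψ₂(u))` is a square. [cite: SilvermanAEC2009, III.2.3 (d)] -/
theorem root_le_of_mul_psiTwo_eq_real {V : WeierstrassCurve ℝ} {u v X e : ℝ} (h : V.toAffine.Equation u v)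
    (hv : v ≠ V.toAffine.negY u v) (hX : X * psiTwo V u = dupNum V u) (he : psiTwo V e = 0) : e ≤ X := by
  have hpsi := sub_negY_sq_eq_psiTwo V h
  have hD : v - V.toAffine.negY u v ≠ 0 := sub_ne_zero.mpr hv
  have hpos : 0 < psiTwo V u := by rw [← hpsi]; positivity
  have hsq := four_mul_dupNum_sub_root_mul_psiTwo V he u
  have hnonneg : 0 ≤ dupNum V u - e * psiTwo V u := by
    nlinarith [hsq, sq_nonneg (2 * u ^ 2 - 4 * e * u - (V.b₄ + V.b₂ * e + 4 * e ^ 2))]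
  have hkey : 0 ≤ (X - e) * psiTwo V u := by
    have h' : (X - e) * psiTwo V u = dupNum V u - e * psiTwo V u := by rw [← hX]; ring
    rw [h']
    exact hnonneg
  by_contra hlt
  have hneg : (X - e) * psiTwo V u < 0 := mul_neg_of_neg_of_pos (sub_neg.mpr (lt_of_not_ge hlt)) hpos
  exact absurd hkey (not_le.mpr hneg)

/-- **`2E(ℝ)` misses the egg.** If `R + R = (x, y)` in `E(ℝ)` for a real point `R` and a rational abscissa `x`, then `x` is not on
the egg (`x ≥` every real root of `ψ₂`: doubles lie on the identity component of `E(ℝ)`).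
[cite: Kramer1981, §2 Prop. 6 (p. 127)] [cite: SilvermanAEC2009, III.2.3 (d)] -/
theorem not_onEgg_of_add_self_eq_real (R : (W.baseChange ℝ).toAffine.Point) {x y : ℚ}
    {hxy : (W.baseChange ℝ).toAffine.Nonsingular (algebraMap ℚ ℝ x) (algebraMap ℚ ℝ y)}
    (hR : R + R = .some (algebraMap ℚ ℝ x) (algebraMap ℚ ℝ y) hxy) : ¬ OnEgg W x := by
  rintro ⟨e, he, hlt⟩
  have he' : psiTwo (W.baseChange ℝ) e = 0 := by rw [psiTwo_baseChange_real]; exact he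
  have hxR : algebraMap ℚ ℝ x = (x : ℝ) := eq_ratCast _ x
  rcases R with _ | ⟨u, v, huv⟩
  · rw [← Affine.Point.zero_def, add_zero] at hR
    exact absurd hR.symm (Affine.Point.some_ne_zero _)
  · by_cases hy : v = (W.baseChange ℝ).toAffine.negY u v
    · rw [Affine.Point.add_self_of_Y_eq hy] at hR
      exact absurd hR.symm (Affine.Point.some_ne_zero _)
    · rw [Affine.Point.add_self_of_Y_ne hy] at hR
      have hx' : (W.baseChange ℝ).toAffine.addX u u ((W.baseChange ℝ).toAffine.slope u u v v) = (x : ℝ) := by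
        rw [← hxR]
        exact (Affine.Point.some.inj hR).1
      have hX := addX_self_mul_psiTwo (W.baseChange ℝ) huv.1 hy
      rw [hx'] at hX
      exact absurd (root_le_of_mul_psiTwo_eq_real huv.1 hy hX he') (not_le.mpr hlt)

/-- **`2E(K)` misses the egg for every `ℚ`-field `K` with a ring homomorphism to `ℝ`** (e.g. `K = ℚ_∞`, the completion of `ℚ` at
its real place): transport along `K → ℝ`, then `not_onEgg_of_add_self_eq_real`. [cite: Kramer1981, §2 Prop. 6 (p. 127)] -/
theorem not_onEgg_of_add_self_eq_baseChange {K : Type u} [Field K] [Algebra ℚ K] (e : K →+* ℝ)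
    (R : (W.baseChange K).toAffine.Point) {x y : ℚ}
    {hxy : (W.baseChange K).toAffine.Nonsingular (algebraMap ℚ K x) (algebraMap ℚ K y)}
    (hR : R + R = .some (algebraMap ℚ K x) (algebraMap ℚ K y) hxy) : ¬ OnEgg W x := by
  let f : K →ₐ[ℚ] ℝ := e.toRatAlgHom
  have h := congrArg (Affine.Point.map (W' := W) f) hR
  rw [map_add, Affine.Point.map_some] at h
  have hfx : f (algebraMap ℚ K x) = algebraMap ℚ ℝ x := f.commutes x
  have hfy : f (algebraMap ℚ K y) = algebraMap ℚ ℝ y := f.commutes y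
  obtain ⟨h', hP⟩ : ∃ h', Affine.Point.map (W' := W) f R + Affine.Point.map (W' := W) f R =
      .some (algebraMap ℚ ℝ x) (algebraMap ℚ ℝ y) h' := by
    refine ⟨?_, h.trans ?_⟩
    · rw [← hfx, ← hfy]
      exact (W.toAffine.baseChange_nonsingular (f := f) f.toRingHom.injective _ _).mpr hxy
    · simp only [hfx, hfy]
  exact not_onEgg_of_add_self_eq_real W _ hP

/-- **`Δ > 0` ⟹ the `2`-torsion of `W/ℝ` is rational** (three real roots): the roots over `ℂ` are a real one and either two more
real ones or a conjugate pair, the latter forcing `Δ < 0`. [cite: Kramer1981, §2 Prop. 6 (p. 127), the dichotomy on the sign of Δ] -/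
theorem exists_splitTwoTorsion_baseChange_real_of_Δ_pos [W.IsElliptic] (hΔ : 0 < W.Δ) :
    ∃ e₁ e₂ e₃ : ℝ, (W.baseChange ℝ).toAffine.SplitTwoTorsion e₁ e₂ e₃ := by
  have hΔ' : 0 < (W.baseChange ℝ).Δ := by
    have h : (W.baseChange ℝ).Δ = algebraMap ℚ ℝ W.Δ := W.map_Δ _
    rw [h, eq_ratCast]
    exact_mod_cast hΔ
  obtain ⟨c₁, c₂, c₃, h, h₁, hor⟩ := Kramer1981.exists_splitTwoTorsion_conj (W.baseChange ℝ)
  have h₂₃ : conj c₂ = c₂ ∧ conj c₃ = c₃ := by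
    rcases hor with h' | h'
    · exact h'
    · exact absurd hΔ' (not_lt.mpr (Kramer1981.Δ_neg_of_conj_pair (W.baseChange ℝ) h h₁ h').le)
  obtain ⟨r₁, rfl⟩ := Complex.conj_eq_iff_real.mp h₁
  obtain ⟨r₂, rfl⟩ := Complex.conj_eq_iff_real.mp h₂₃.1
  obtain ⟨r₃, rfl⟩ := Complex.conj_eq_iff_real.mp h₂₃.2
  have cb₂ : ((W.baseChange ℝ).baseChange ℂ).b₂ = (((W.baseChange ℝ).b₂ : ℝ) : ℂ) := (W.baseChange ℝ).map_b₂ _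
  have cb₄ : ((W.baseChange ℝ).baseChange ℂ).b₄ = (((W.baseChange ℝ).b₄ : ℝ) : ℂ) := (W.baseChange ℝ).map_b₄ _
  have cb₆ : ((W.baseChange ℝ).baseChange ℂ).b₆ = (((W.baseChange ℝ).b₆ : ℝ) : ℂ) := (W.baseChange ℝ).map_b₆ _
  have hb₂ := h.b₂_eq
  have hb₄ := h.b₄_eq
  have hb₆ := h.b₆_eq
  change ((W.baseChange ℝ).baseChange ℂ).b₂ = _ at hb₂
  change ((W.baseChange ℝ).baseChange ℂ).b₄ = _ at hb₄
  change ((W.baseChange ℝ).baseChange ℂ).b₆ = _ at hb₆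
  rw [cb₂] at hb₂
  rw [cb₄] at hb₄
  rw [cb₆] at hb₆
  refine ⟨r₁, r₂, r₃, ⟨?_, ?_, ?_⟩⟩
  · change (W.baseChange ℝ).b₂ = _
    exact_mod_cast hb₂
  · change (W.baseChange ℝ).b₄ = _
    exact_mod_cast hb₄
  · change (W.baseChange ℝ).b₆ = _
    exact_mod_cast hb₆

/-- **Off the egg, a rational point halves over `ℝ`** (`Δ > 0`, `ψ₂(x) ≠ 0`): with the three real roots `e_i` of `ψ₂`, `¬ OnEgg W x`
says `e_i ≤ x`, `ψ₂(x) ≠ 0` makes it strict, so every `x − e_i` is a positive real, hence a square, and the complete `2`-descent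
(`Affine.Point.exists_add_self_of_twoDescentComponent_eq_one`, Silverman X.1.4) halves the point: `P_ℝ ∈ 2E(ℝ) = E⁰(ℝ)`.
[cite: Kramer1981, §2 Prop. 6 (p. 127)] [cite: SilvermanAEC2009, Prop. X.1.4] [cite: Knapp1993, Thm. 4.2] -/
theorem exists_add_self_eq_real_of_not_onEgg [W.IsElliptic] (hΔ : 0 < W.Δ) {x y : ℚ} (hx : psiTwo W x ≠ 0)
    (hegg : ¬ OnEgg W x) (hxy : (W.baseChange ℝ).toAffine.Nonsingular (algebraMap ℚ ℝ x) (algebraMap ℚ ℝ y)) :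
    ∃ Q : (W.baseChange ℝ).toAffine.Point, Q + Q = .some (algebraMap ℚ ℝ x) (algebraMap ℚ ℝ y) hxy := by
  obtain ⟨e₁, e₂, e₃, hs⟩ := exists_splitTwoTorsion_baseChange_real_of_Δ_pos W hΔ
  have hxR : algebraMap ℚ ℝ x = (x : ℝ) := eq_ratCast _ x
  -- every real root of `ψ₂` is `< x`
  have hroot : ∀ e : ℝ, psiTwo (W.baseChange ℝ) e = 0 → e < algebraMap ℚ ℝ x := fun e he ↦ by
    rw [hxR]
    have hle : e ≤ (x : ℝ) := not_lt.mp fun hlt ↦ hegg ⟨e, by rwa [psiTwo_baseChange_real] at he, hlt⟩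
    rcases hle.lt_or_eq with hlt | heq
    · exact hlt
    · exfalso
      apply hx
      have h0 : psiTwo (W.baseChange ℝ) (algebraMap ℚ ℝ x) = 0 := by rw [hxR, ← heq]; exact he
      have h1 : psiTwo (W.baseChange ℝ) (algebraMap ℚ ℝ x) = algebraMap ℚ ℝ (psiTwo W x) :=
        psiTwo_map W (algebraMap ℚ ℝ) x
      rw [h1, map_eq_zero_iff _ (algebraMap ℚ ℝ).injective] at h0
      exact h0
  have h1 : psiTwo (W.baseChange ℝ) e₁ = 0 := by rw [psiTwo_eq_of_splitTwoTorsion hs]; ring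
  have h2 : psiTwo (W.baseChange ℝ) e₂ = 0 := by rw [psiTwo_eq_of_splitTwoTorsion hs]; ring
  have hlt₁ := hroot e₁ h1
  have hlt₂ := hroot e₂ h2
  have hsq : ∀ e : ℝ, e < algebraMap ℚ ℝ x → Affine.sqClass (algebraMap ℚ ℝ x - e) = 1 := fun e he ↦
    (Affine.sqClass_eq_one_iff (sub_ne_zero.mpr (ne_of_gt he))).mpr
      ⟨Real.sqrt (algebraMap ℚ ℝ x - e), (Real.sq_sqrt (sub_nonneg.mpr he.le)).symm⟩
  have hc₁ : Affine.Point.twoDescentComponent (W.baseChange ℝ).toAffine e₁ e₂ e₃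
      (.some (algebraMap ℚ ℝ x) (algebraMap ℚ ℝ y) hxy) = 1 := by
    rw [Affine.Point.twoDescentComponent_some_of_ne _ (ne_of_gt hlt₁)]
    exact hsq e₁ hlt₁
  have hc₂ : Affine.Point.twoDescentComponent (W.baseChange ℝ).toAffine e₂ e₁ e₃
      (.some (algebraMap ℚ ℝ x) (algebraMap ℚ ℝ y) hxy) = 1 := by
    rw [Affine.Point.twoDescentComponent_some_of_ne _ (ne_of_gt hlt₂)]
    exact hsq e₂ hlt₂
  exact Affine.Point.exists_add_self_of_twoDescentComponent_eq_one hs _ hc₁ hc₂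

/-- **Off the egg, a rational point halves in `E(K)` for every `ℚ`-field `K ≃+* ℝ`** (e.g. `K = ℚ_∞`): halve over `ℝ` and transport
back along `ℝ → K`. [cite: Kramer1981, §2 Prop. 6 (p. 127)] [cite: SilvermanAEC2009, Prop. X.1.4] -/
theorem exists_add_self_eq_baseChange_of_not_onEgg [W.IsElliptic] {K : Type u} [Field K] [Algebra ℚ K] (e : K ≃+* ℝ)
    (hΔ : 0 < W.Δ) {x y : ℚ} (hx : psiTwo W x ≠ 0) (hegg : ¬ OnEgg W x)
    (hxy : (W.baseChange K).toAffine.Nonsingular (algebraMap ℚ K x) (algebraMap ℚ K y)) :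
    ∃ Q : (W.baseChange K).toAffine.Point, Q + Q = .some (algebraMap ℚ K x) (algebraMap ℚ K y) hxy := by
  let f : K →ₐ[ℚ] ℝ := e.toRingHom.toRatAlgHom
  let g : ℝ →ₐ[ℚ] K := e.symm.toRingHom.toRatAlgHom
  have hgx : g (algebraMap ℚ ℝ x) = algebraMap ℚ K x := g.commutes x
  have hgy : g (algebraMap ℚ ℝ y) = algebraMap ℚ K y := g.commutes y
  have hxyR : (W.baseChange ℝ).toAffine.Nonsingular (algebraMap ℚ ℝ x) (algebraMap ℚ ℝ y) := by
    rw [← f.commutes x, ← f.commutes y]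
    exact (W.toAffine.baseChange_nonsingular (f := f) f.toRingHom.injective _ _).mpr hxy
  obtain ⟨Q, hQ⟩ := exists_add_self_eq_real_of_not_onEgg W hΔ hx hegg hxyR
  refine ⟨Affine.Point.map (W' := W) g Q, ?_⟩
  have h := congrArg (Affine.Point.map (W' := W) g) hQ
  rw [map_add, Affine.Point.map_some] at h
  refine h.trans ?_
  simp only [hgx, hgy]

end RealEgg

/-! ## §74 The dictionary: the egg is the real place of `Sel₂(W)` -/

section Localization

variable {K : Type u} [Field K] [NumberField K] (W : WeierstrassCurve K) [W.IsElliptic]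

/-- **`loc_v κ_n(P) = κ_{n,v}(P_v)`** at every place `v` of a number field: the localisation (`galoisCohomology.localization`, i.e.
restriction to `Γ_{K_v}`) of the global Kummer class of `P ∈ E(K)` is the local Kummer map of `E(K_v)` at the base-changed point
(tree X11b `res_kummerMapTorsion_eq_localKummerMap`, read at `K_v = Place.Completion v`). [cite: SilvermanAEC2009, X.§4 diagram (**)] -/
theorem localization_kummerMapTorsion_eq_localKummerMap {n : ℤ} (hn : n ≠ 0)
    (hdiv : ∀ P : geomPoints W, ∃ Q : geomPoints W, n • Q = P) (v : Place K) (P : W.toAffine.Point) :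
    galoisCohomology.localization (W.torsionGaloisModule n) v 1 (kummerMapTorsion W n hdiv P) =
      W.localKummerMap (Place.Completion v) hn (Affine.Point.baseChange (W' := W) K (Place.Completion v) P) :=
  Rank1Residual.X11b.KummerIndex.res_kummerMapTorsion_eq_localKummerMap W _ hn hdiv P

/-- **`loc_v κ_n(P) = 0 ⟺ P_v ∈ nE(K_v)`** (exactness of the local Kummer sequence at `E(K_v)/n`, tree `ker_localKummerMap`).
[cite: SilvermanAEC2009, VIII.§2 and X.§4 diagram (**)] -/
theorem localization_kummerMapTorsion_eq_zero_iff {n : ℤ} (hn : n ≠ 0)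
    (hdiv : ∀ P : geomPoints W, ∃ Q : geomPoints W, n • Q = P) (v : Place K) (P : W.toAffine.Point) :
    galoisCohomology.localization (W.torsionGaloisModule n) v 1 (kummerMapTorsion W n hdiv P) = 0 ↔
      ∃ R : (W.baseChange (Place.Completion v)).toAffine.Point,
        n • R = Affine.Point.baseChange (W' := W) K (Place.Completion v) P := by
  haveI : CharZero (Place.Completion v) := charZero_of_injective_algebraMap (algebraMap K _).injective
  rw [localization_kummerMapTorsion_eq_localKummerMap W hn hdiv v P]
  have hk := SetLike.ext_iff.mp (W.ker_localKummerMap (Place.Completion v) hn)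
    (Affine.Point.baseChange (W' := W) K (Place.Completion v) P)
  rw [AddMonoidHom.mem_ker, AddMonoidHom.mem_range] at hk
  exact hk

end Localization

section Dictionary

variable (W : WeierstrassCurve ℚ) [W.IsElliptic]

omit [W.IsElliptic] in
/-- `E(ℚ̄)` is `2`-divisible (the input `hdiv` of the global Kummer map `κ₂`). [folklore] -/
theorem hdiv_two : ∀ P : geomPoints W, ∃ Q : geomPoints W, ((2 : ℕ) : ℤ) • Q = P :=
  W.zsmul_geomPoints_surjective_of_charZero (by norm_num)

/-- **`MeetsEgg W ⟹` some class of `Sel₂(W)` is non-trivial at `∞`** (ANY elliptic `W/ℚ`; no hypothesis on `Δ`, torsion, rank or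
`Ш`): the Kummer class `κ(P)` of a rational point `P` on the egg lies in `Sel₂(W)` and localises at the real place to `κ_∞(P_∞)`,
which vanishes iff `P_∞ ∈ 2E(ℚ_∞)` — impossible on the egg (`not_onEgg_of_add_self_eq_baseChange` along `ℚ_∞ → ℝ`).
[cite: Kramer1981, §2 Prop. 6 (p. 127)] [cite: SilvermanAEC2009, X.§4 diagram (**)] -/
theorem exists_mem_selmerGroup_localization_inl_ne_zero_of_meetsEgg (hegg : MeetsEgg W) :
    ∃ c ∈ (W.kummerSelmerStructure ((2 : ℕ) : ℤ)).selmerGroup,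
      galoisCohomology.localization (W.torsionGaloisModule ((2 : ℕ) : ℤ)) (Sum.inl Rat.infinitePlace) 1 c ≠ 0 := by
  obtain ⟨x, y, hxy, hon⟩ := hegg
  have hns : W.toAffine.Nonsingular x y := (Affine.equation_iff_nonsingular (W := W)).mp hxy
  have h2 : ((2 : ℕ) : ℤ) ≠ 0 := by norm_num
  refine ⟨kummerMapTorsion W _ (hdiv_two W) (.some x y hns), ?_, ?_⟩
  · exact (SetLike.ext_iff.mp (W.selmerGroup_eq_selmerGroup_kummerSelmerStructure _) _).mp
      (kummerMapTorsion_mem_selmerGroup W _ (hdiv_two W) _)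
  · intro h0
    rw [localization_kummerMapTorsion_eq_zero_iff W h2 (hdiv_two W)] at h0
    obtain ⟨R, hR⟩ := h0
    rw [Nat.cast_ofNat, two_zsmul] at hR
    change R + R = .some (algebraMap ℚ _ x) (algebraMap ℚ _ y) _ at hR
    have e : Place.Completion (Sum.inl Rat.infinitePlace : Place ℚ) →+* ℝ :=
      (InfinitePlace.Completion.ringEquivRealOfIsReal Rat.isReal_infinitePlace).toRingHom
    exact not_onEgg_of_add_self_eq_baseChange W e R hR hon

/-- **`¬ MeetsEgg W ⟹ Sel₂(W)` is strict at `∞`** under `Δ > 0`, `E(ℚ)[2] = 0`, `Ш(W)[2] = 0`: every Selmer class dies in `H¹(ℚ, E)`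
(its image lies in `Ш(W) ∩ H¹(ℚ,E)[2] = 0`), hence is a Kummer class `κ(P)` of a rational point (exactness of the Kummer sequence);
`P` is off the egg and `ψ₂(x(P)) ≠ 0` (no rational `2`-torsion), so `P_∞ ∈ 2E(ℚ_∞)` (`exists_add_self_eq_baseChange_of_not_onEgg`)
and `loc_∞ κ(P) = κ_∞(P_∞) = 0`. [cite: Kramer1981, §2 Prop. 6 (p. 127)] [cite: SilvermanAEC2009, Thm X.4.2(a)] -/
theorem forall_mem_selmerGroup_localization_inl_eq_zero_of_not_meetsEgg (hΔ : 0 < W.Δ) (hT : NoRationalTwoTorsion W)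
    (hSha : ShaTwoTrivial W) (hegg : ¬ MeetsEgg W) :
    ∀ c ∈ (W.kummerSelmerStructure ((2 : ℕ) : ℤ)).selmerGroup,
      galoisCohomology.localization (W.torsionGaloisModule ((2 : ℕ) : ℤ)) (Sum.inl Rat.infinitePlace) 1 c = 0 := by
  intro c hc
  have h2 : ((2 : ℕ) : ℤ) ≠ 0 := by norm_num
  have hc' : c ∈ selmerGroup W ((2 : ℕ) : ℤ) :=
    (SetLike.ext_iff.mp (W.selmerGroup_eq_selmerGroup_kummerSelmerStructure _) c).mpr hc
  -- `c` dies in `H¹(ℚ, E)`: its image lies in `Ш(W) ∩ H¹(ℚ, E)[2] = 0`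
  have himg : torsionH1ToH1 W _ c ∈ W.sha ⊓ AddSubgroup.torsionBy W.galH1 ((2 : ℕ) : ℤ) := by
    rw [← WeierstrassCurve.map_torsionH1ToH1_selmerGroup_holds W h2]
    exact ⟨c, hc', rfl⟩
  have hzero : torsionH1ToH1 W _ c = 0 :=
    hSha _ (AddSubgroup.mem_inf.mp himg).1 (AddSubgroup.torsionBy.nsmul_iff.mp (AddSubgroup.mem_inf.mp himg).2)
  -- hence `c = κ(P)` for a rational point `P`
  obtain ⟨P, hP⟩ := mem_range_kummerMapTorsion_of_torsionH1ToH1_eq_zero W _ (hdiv_two W) c hzero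
  rw [← hP, localization_kummerMapTorsion_eq_zero_iff W h2 (hdiv_two W)]
  rcases P with _ | ⟨x, y, hxy⟩
  · exact ⟨0, by rw [zsmul_zero]; rfl⟩
  · have hx : psiTwo W x ≠ 0 := psiTwo_ne_zero W hT x
    have hoff : ¬ OnEgg W x := fun h ↦ hegg ⟨x, y, hxy.1, h⟩
    have e : Place.Completion (Sum.inl Rat.infinitePlace : Place ℚ) ≃+* ℝ :=
      InfinitePlace.Completion.ringEquivRealOfIsReal Rat.isReal_infinitePlace
    obtain ⟨h', hP'⟩ : ∃ h', Affine.Point.baseChange (W' := W) ℚ (Place.Completion (Sum.inl Rat.infinitePlace : Place ℚ))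
        (.some x y hxy) = .some (algebraMap ℚ _ x) (algebraMap ℚ _ y) h' := ⟨_, rfl⟩
    obtain ⟨Q, hQ⟩ := exists_add_self_eq_baseChange_of_not_onEgg W e hΔ hx hoff h'
    refine ⟨Q, ?_⟩
    rw [Nat.cast_ofNat, two_zsmul, hQ]
    rfl

/-- **The egg is the real place of `Sel₂(W)`** (no parity, no image hypothesis): for `Δ_W > 0`, `E(ℚ)[2] = 0`, `Ш(W)[2] = 0`,
`E(ℚ)` meets the egg iff some class of `Sel₂(W)` is non-trivial at `∞`. [cite: Kramer1981, §2 Prop. 6 (p. 127)] -/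
theorem meetsEgg_iff_exists_localization_inl_ne_zero (hΔ : 0 < W.Δ) (hT : NoRationalTwoTorsion W) (hSha : ShaTwoTrivial W) :
    MeetsEgg W ↔
      ∃ c ∈ (W.kummerSelmerStructure ((2 : ℕ) : ℤ)).selmerGroup,
        galoisCohomology.localization (W.torsionGaloisModule ((2 : ℕ) : ℤ)) (Sum.inl Rat.infinitePlace) 1 c ≠ 0 := by
  refine ⟨exists_mem_selmerGroup_localization_inl_ne_zero_of_meetsEgg W, fun ⟨c, hc, hne⟩ ↦ ?_⟩
  by_contra hegg
  exact hne (forall_mem_selmerGroup_localization_inl_eq_zero_of_not_meetsEgg W hΔ hT hSha hegg c hc)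

/-- **`#Sel₂(W) = 2` for rank one, `E(ℚ)[2] = 0`, `Ш(W)[2] = 0`** — the descent count
`#Sel₂ = 2^{rank} · #E(ℚ)[2] · #Ш[2]` (tree `card_selmerGroup_eq_pow_rank_mul`). [cite: SilvermanAEC2009, Thm X.4.2(a) and VIII.6] -/
theorem selmerTwoCard_eq_two_of_rank_one (hT : NoRationalTwoTorsion W) (hrank : W.mordellWeilRank = 1)
    (hSha : ShaTwoTrivial W) : selmerTwoCard W = 2 := by
  -- `E(ℚ)`'s group law takes a `DecidableEq ℚ`; the general descent count carries the classical instance: transport along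
  -- `Subsingleton.elim` (as in `Typed/HigherDescentSelmerCertificate.lean`).
  have hinst : (instDecidableEqRat : DecidableEq ℚ) = fun a b => Classical.propDecidable (a = b) := Subsingleton.elim _ _
  have ht : Nat.card (AddSubgroup.torsionBy W.toAffine.Point ((2 : ℕ) : ℤ)) = 1 := by
    have hbot : AddSubgroup.torsionBy W.toAffine.Point ((2 : ℕ) : ℤ) = ⊥ :=
      (AddSubgroup.eq_bot_iff_forall _).mpr fun P hP ↦
        eq_zero_of_two_smul_eq_zero W hT P (AddSubgroup.torsionBy.nsmul_iff.mp hP)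
    rw [hbot, AddSubgroup.card_bot]
  rw [hinst] at ht
  have hs : Nat.card (W.sha ⊓ AddSubgroup.torsionBy W.galH1 ((2 : ℕ) : ℕ) : AddSubgroup W.galH1) = 1 := by
    have hbot : (W.sha ⊓ AddSubgroup.torsionBy W.galH1 ((2 : ℕ) : ℕ) : AddSubgroup W.galH1) = ⊥ :=
      (AddSubgroup.eq_bot_iff_forall _).mpr fun a ha ↦
        hSha a (AddSubgroup.mem_inf.mp ha).1 (AddSubgroup.torsionBy.nsmul_iff.mp (AddSubgroup.mem_inf.mp ha).2)
    rw [hbot, AddSubgroup.card_bot]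
  have h := card_selmerGroup_eq_pow_rank_mul W 2
  rw [ht, hs, hrank, mul_one, mul_one, pow_one, Nat.cast_ofNat] at h
  exact h

end Dictionary

end Summit.BirchSwinnertonDyer.BirchSwinnertonDyer.Theorems.GenusKolyArch

end
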